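import Summits.KontsevichZagierPeriods.KontsevichZagierPeriods.Theses.HurwitzMicroSectors
import Summits.KontsevichZagierPeriods.KontsevichZagierPeriods.Theorems.HurwitzMicroSectorsNormalFormPrinciplePiBoxTransfer
import Summits.KontsevichZagierPeriods.KontsevichZagierPeriods.Theorems.HurwitzMicroSectorsNormalFormPrincipleVariants2204

/-! TTRL-lite variant V2211 of stmt-KontsevichZagierPeriods-3869

Variant V2211 = `stub_boxRigidity` (BoxRigidity: two representations on open unit boxes with
integrands of KZ's rational shape and equal values are KZ-equivalent) under the JOINT bound
`bound_nat:m≤2; bound_nat:m'≤3`. Verdict of the attempt seat: **open** — this file is the exact-strength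
certificate and the precise residual, not a proof of the variant. A one-sided bound is the whole leaf
(V2200/V2241/V2256: the bounded side still contains the rational constants); a joint bound is a genuine
fragment pinned to ONE dimension, the larger of the two bounds (here `3`; cf. the mirror V2239 and
`boxRigidityLe_iff_boxVanishing`, file `…Variants2239`, landed in parallel; the padding /
subtraction / zero-representation lemmas are reused from the square fragment V2204, file `…Variants2204`):

* `boxRigidityBounded_iff_boxVanishing K` / `boxRigidityBounded_iff_same K`: BoxRigidity for all pairs
  of dimensions `m, m' ≤ K` ⟺ BoxVanishing in the single dimension `K` (a box-rational representation on
  `(0,1)ᴷ` of value `0` is a relation) ⟺ BoxRigidity for pairs of the SAME dimension `K`. Tools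
  (`…Variants2204`): padding by unit intervals and subtraction on a common box (`pad_le`, `sub_same` of
  the landed stub `stub_boxCombine`), soundness (`relations_le_ker_eval_holds`), the zero representation.
* `stub_boxRigidity_var2211_iff_boxVanishing_three`: **V2211 ⟺ BoxVanishing(3)** — the residual goal.
  `stub_boxRigidity_var2211_iff_mirror`, `…_iff_le_three`, `…_iff_three_three`: the asymmetric bound
  `(2,3)` is the SAME statement as its mirror `(3,2)` (= V2239), as the symmetric bound `(3,3)`, and as
  Conjecture 1 for pairs of box-rational representations both on the open unit CUBE: tightening `m ≤ 3`
  to `m ≤ 2` bought nothing.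
* `stub_boxRigidity_var2211_of_statement` / `_of_parent`: Summit ⇒ parent ⇒ V2211, so the variant is
  not refutable short of refuting Conjecture 1 for the tree's calculus.
* Why it is not provable now: V2211 proves Conjecture 1 UNCONDITIONALLY on every weight-2 AND every
  weight-3 Hurwitz box sector `P(t)/(1 − tᴸ)` (`t = x₀x₁`, resp. `x₀x₁x₂`; any level `L ≠ 0`):
  `sectorTwo_of_stub_boxRigidity_var2211`, `sectorThree_of_stub_boxRigidity_var2211`. The route closes
  such rungs only one at a time and only given the matching linear-independence THEOREM — `(2,6)` by
  Calegari–Dimitrov–Tang, `(3,2)` by Apéry — and files `(2,4)` against the open `Indep_ℚ(1, π², G)`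
  (Catalan) and `(3,3)` against the open `Indep_ℚ(1, ζ(3), π³√3)`. Concretely BoxVanishing(3) contains,
  for every `p/q ∈ ℚ`, "`G = p/q ⇒ [q/(1+x²y²) − p]_□ is a relation`" and
  "`ζ(3) = (p/q)·π³ ⇒ [q/(1−xyz)] ∼ [64p/((1+x²)(1+y²)(1+z²))]`": nobody can produce these chains of
  moves and nobody can exclude the premises. (Both dimensions `≤ 1` is the theorem
  `boxRigidity_of_le_one`, by Baker; dimension `2` is the first open one; V2211 lives in dimension `3`.)
Source: M. Kontsevich, D. Zagier, *Periods* (2001), §1.1–1.2 (Conjecture 1, rules 1)–3)); route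
HurwitzMicroSectors rung table. Pure proof file, no definitions. -/

-- `Summit.<Summit>.<Problem>` is the tree's mandated summit-side namespace (CONVENTIONS §2); for this
-- single-conjunct summit the two coincide, so the duplicate is deliberate.
set_option linter.dupNamespace false

noncomputable section

namespace Summit.KontsevichZagierPeriods.KontsevichZagierPeriods.Theorems

open MeasureTheory Set
open Literature.NumberTheory.Transcendental Literature.NumberTheory.Transcendental.KZ
open Summit.KontsevichZagierPeriods.KontsevichZagierPeriods.Theses.HurwitzMicroSectors
open Summit.KontsevichZagierPeriods.HurwitzMicroSectors.NormalFormPrinciple.PiBox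

/-! ## BoxRigidity with a joint bound `K` is BoxVanishing in the single dimension `K` -/

/-- **BoxRigidity with the joint bound `m, m' ≤ K` ⟺ BoxVanishing in dimension `K`** (→: compare with
the zero representation on the `K`-box, `boxVanishingAt_of_boxRigidityAt`; ←: pad both representations
to the `K`-box and subtract on it, `boxRigidityLe_of_boxVanishingAt`; both from `…Variants2204`).
[cite: KontsevichZagier2001, §1.2 Conjecture 1] -/
theorem boxRigidityBounded_iff_boxVanishing (K : ℕ) :
    (∀ (m m' : ℕ) (N : IntegralRep m) (N' : IntegralRep m'), m' ≤ K → m ≤ K →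
      N.domain = {x | ∀ i, x i ∈ Set.Ioo (0:ℝ) 1} → N.IsRational →
      N'.domain = {x | ∀ i, x i ∈ Set.Ioo (0:ℝ) 1} → N'.IsRational →
      N.value = N'.value → Equivalent N N') ↔
    (∀ (N : IntegralRep K), N.domain = {x | ∀ i, x i ∈ Set.Ioo (0:ℝ) 1} →
      N.IsRational → N.value = 0 → of N ∈ relations) :=
  ⟨fun h => boxVanishingAt_of_boxRigidityAt K fun N N' => h K K N N' le_rfl le_rfl,
    fun h _ _ N N' hm' hm => boxRigidityLe_of_boxVanishingAt K h hm hm' N N'⟩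

/-- **BoxRigidity with the joint bound `m, m' ≤ K` ⟺ BoxRigidity for pairs of the single dimension
`K`** (padding to the top box costs nothing). [cite: KontsevichZagier2001, §1.2 Conjecture 1] -/
theorem boxRigidityBounded_iff_same (K : ℕ) :
    (∀ (m m' : ℕ) (N : IntegralRep m) (N' : IntegralRep m'), m' ≤ K → m ≤ K →
      N.domain = {x | ∀ i, x i ∈ Set.Ioo (0:ℝ) 1} → N.IsRational →
      N'.domain = {x | ∀ i, x i ∈ Set.Ioo (0:ℝ) 1} → N'.IsRational →
      N.value = N'.value → Equivalent N N') ↔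
    (∀ (N N' : IntegralRep K),
      N.domain = {x | ∀ i, x i ∈ Set.Ioo (0:ℝ) 1} → N.IsRational →
      N'.domain = {x | ∀ i, x i ∈ Set.Ioo (0:ℝ) 1} → N'.IsRational →
      N.value = N'.value → Equivalent N N') :=
  ⟨fun h N N' => h K K N N' le_rfl le_rfl,
    fun h _ _ N N' hm' hm =>
      boxRigidityLe_of_boxVanishingAt K (boxVanishingAt_of_boxRigidityAt K h) hm hm' N N'⟩

/-! ## The variant V2211 itself: Conjecture 1 for box-rational periods of the cube -/

/-- **V2211 ⟺ its mirror** (`m ≤ 3, m' ≤ 2`, which is variant V2239): `KZ.Equivalent` is symmetric,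
so the two bounds may be read on either side (pure logic). [cite: KontsevichZagier2001, §1.2 Conjecture 1] -/
theorem stub_boxRigidity_var2211_iff_mirror :
    (∀ (m m' : ℕ) (N : IntegralRep m) (N' : IntegralRep m'), m' ≤ 3 → m ≤ 2 → N.domain = {x | ∀ i, x i ∈ Set.Ioo (0:ℝ) 1} → N.IsRational → N'.domain = {x | ∀ i, x i ∈ Set.Ioo (0:ℝ) 1} → N'.IsRational → N.value = N'.value → Equivalent N N') ↔
    (∀ (m m' : ℕ) (N : IntegralRep m) (N' : IntegralRep m'), m' ≤ 2 → m ≤ 3 → N.domain = {x | ∀ i, x i ∈ Set.Ioo (0:ℝ) 1} → N.IsRational → N'.domain = {x | ∀ i, x i ∈ Set.Ioo (0:ℝ) 1} → N'.IsRational → N.value = N'.value → Equivalent N N') :=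
  ⟨fun h m m' N N' hm' hm hNd hNr hN'd hN'r hv =>
      (h m' m N' N hm hm' hN'd hN'r hNd hNr hv.symm).symm,
    fun h m m' N N' hm' hm hNd hNr hN'd hN'r hv =>
      (h m' m N' N hm hm' hN'd hN'r hNd hNr hv.symm).symm⟩

/-- **V2211 ⟺ BoxVanishing(3)** — the precise residual of the variant: every representation on the
open unit cube with integrand of KZ's rational shape and value `0` is a KZ relation (→: the slice
`m = 0`, the zero constant, against `m' = 3`; ←: pad to the cube and subtract).
[cite: KontsevichZagier2001, §1.2 Conjecture 1] -/
theorem stub_boxRigidity_var2211_iff_boxVanishing_three :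
    (∀ (m m' : ℕ) (N : IntegralRep m) (N' : IntegralRep m'), m' ≤ 3 → m ≤ 2 → N.domain = {x | ∀ i, x i ∈ Set.Ioo (0:ℝ) 1} → N.IsRational → N'.domain = {x | ∀ i, x i ∈ Set.Ioo (0:ℝ) 1} → N'.IsRational → N.value = N'.value → Equivalent N N') ↔
    (∀ (N : IntegralRep 3), N.domain = {x | ∀ i, x i ∈ Set.Ioo (0:ℝ) 1} →
      N.IsRational → N.value = 0 → of N ∈ relations) := by
  refine ⟨fun h N hNd hNr hv => ?_,
    fun h m m' N N' hm' hm => boxRigidityLe_of_boxVanishingAt 3 h (hm.trans (by norm_num)) hm' N N'⟩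
  obtain ⟨Z, hZd, hZi⟩ := exists_zeroRep (isSemialgebraic_box 0)
  have hZ : of Z ∈ relations := of_mem_relations_of_eqOn_zero Z (by simp [hZi, EqOn])
  have hZv : Z.value = 0 := by simp [IntegralRep.value, hZi]
  have hZr : Z.IsRational := ⟨0, 1, fun x _ => by simp, fun x _ => by simp [hZi]⟩
  have h' : of Z - of N ∈ relations :=
    h 0 3 Z N le_rfl (Nat.zero_le 2) hZd hZr hNd hNr (by rw [hv, hZv])
  have := relations.sub_mem hZ h'
  rwa [sub_sub_cancel] at this

/-- **V2211 ⟺ BoxRigidity with the symmetric joint bound `m, m' ≤ 3`**: tightening the left bound from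
`3` to `2` (the move `bound_nat:m≤2`) does not weaken the statement.
[cite: KontsevichZagier2001, §1.2 Conjecture 1] -/
theorem stub_boxRigidity_var2211_iff_le_three :
    (∀ (m m' : ℕ) (N : IntegralRep m) (N' : IntegralRep m'), m' ≤ 3 → m ≤ 2 → N.domain = {x | ∀ i, x i ∈ Set.Ioo (0:ℝ) 1} → N.IsRational → N'.domain = {x | ∀ i, x i ∈ Set.Ioo (0:ℝ) 1} → N'.IsRational → N.value = N'.value → Equivalent N N') ↔
    (∀ (m m' : ℕ) (N : IntegralRep m) (N' : IntegralRep m'), m' ≤ 3 → m ≤ 3 →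
      N.domain = {x | ∀ i, x i ∈ Set.Ioo (0:ℝ) 1} → N.IsRational →
      N'.domain = {x | ∀ i, x i ∈ Set.Ioo (0:ℝ) 1} → N'.IsRational →
      N.value = N'.value → Equivalent N N') := by
  rw [stub_boxRigidity_var2211_iff_boxVanishing_three, boxRigidityBounded_iff_boxVanishing]

/-- **V2211 ⟺ Conjecture 1 for pairs of box-rational representations on the open unit cube** (both
dimensions exactly `3`). [cite: KontsevichZagier2001, §1.2 Conjecture 1] -/
theorem stub_boxRigidity_var2211_iff_three_three :
    (∀ (m m' : ℕ) (N : IntegralRep m) (N' : IntegralRep m'), m' ≤ 3 → m ≤ 2 → N.domain = {x | ∀ i, x i ∈ Set.Ioo (0:ℝ) 1} → N.IsRational → N'.domain = {x | ∀ i, x i ∈ Set.Ioo (0:ℝ) 1} → N'.IsRational → N.value = N'.value → Equivalent N N') ↔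
    (∀ (N N' : IntegralRep 3),
      N.domain = {x | ∀ i, x i ∈ Set.Ioo (0:ℝ) 1} → N.IsRational →
      N'.domain = {x | ∀ i, x i ∈ Set.Ioo (0:ℝ) 1} → N'.IsRational →
      N.value = N'.value → Equivalent N N') := by
  rw [stub_boxRigidity_var2211_iff_le_three, boxRigidityBounded_iff_same]

/-- **V2211 ⇒ BoxVanishing in every dimension `m ≤ 3`** (descend from the cube by padding): so V2211
contains the theorem `boxRigidity_of_le_one` (dimensions `≤ 1`, Baker), the open square fragment
BoxVanishing(2) (variant V2204), and adds exactly the cube. [cite: KontsevichZagier2001, §1.2 Conjecture 1] -/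
theorem boxVanishing_le_three_of_stub_boxRigidity_var2211
    (h : ∀ (m m' : ℕ) (N : IntegralRep m) (N' : IntegralRep m'), m' ≤ 3 → m ≤ 2 → N.domain = {x | ∀ i, x i ∈ Set.Ioo (0:ℝ) 1} → N.IsRational → N'.domain = {x | ∀ i, x i ∈ Set.Ioo (0:ℝ) 1} → N'.IsRational → N.value = N'.value → Equivalent N N')
    {m : ℕ} (hm : m ≤ 3) (N : IntegralRep m) (hNd : N.domain = {x | ∀ i, x i ∈ Set.Ioo (0:ℝ) 1})
    (hNr : N.IsRational) (hv : N.value = 0) : of N ∈ relations :=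
  boxVanishingLe_of_boxVanishingAt 3 (stub_boxRigidity_var2211_iff_boxVanishing_three.1 h) hm N hNd hNr hv

/-- **The parent leaf gives V2211** (drop the bounds; the converse is not claimed — the parent is
BoxVanishing in ALL dimensions). [cite: KontsevichZagier2001, §1.2 Conjecture 1] -/
theorem stub_boxRigidity_var2211_of_parent
    (h : ∀ (m m' : ℕ) (N : IntegralRep m) (N' : IntegralRep m'), N.domain = {x | ∀ i, x i ∈ Set.Ioo (0:ℝ) 1} → N.IsRational → N'.domain = {x | ∀ i, x i ∈ Set.Ioo (0:ℝ) 1} → N'.IsRational → N.value = N'.value → Equivalent N N') :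
    ∀ (m m' : ℕ) (N : IntegralRep m) (N' : IntegralRep m'), m' ≤ 3 → m ≤ 2 → N.domain = {x | ∀ i, x i ∈ Set.Ioo (0:ℝ) 1} → N.IsRational → N'.domain = {x | ∀ i, x i ∈ Set.Ioo (0:ℝ) 1} → N'.IsRational → N.value = N'.value → Equivalent N N' :=
  fun m m' N N' _ _ => h m m' N N'

/-- **`KontsevichZagierPeriods ⇒ V2211`**: the variant is a special case of Conjecture 1 for the tree's
calculus (`leaves_of_statement`) — a refutation of the variant would refute the Summit.
[cite: KontsevichZagier2001, §1.2 Conjecture 1] -/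
theorem stub_boxRigidity_var2211_of_statement (h : _root_.KontsevichZagierPeriods) :
    ∀ (m m' : ℕ) (N : IntegralRep m) (N' : IntegralRep m'), m' ≤ 3 → m ≤ 2 → N.domain = {x | ∀ i, x i ∈ Set.Ioo (0:ℝ) 1} → N.IsRational → N'.domain = {x | ∀ i, x i ∈ Set.Ioo (0:ℝ) 1} → N'.IsRational → N.value = N'.value → Equivalent N N' :=
  stub_boxRigidity_var2211_of_parent (leaves_of_statement h).1

/-! ## What V2211 would settle: every weight-2 and weight-3 Hurwitz box sector, unconditionally -/

/-- A weight-3 Hurwitz sector member (open cube, integrand `P(x₀x₁x₂)/(1 − (x₀x₁x₂)ᴸ)` on it,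
`L ≠ 0`, `P ∈ ℚ[t]`) has KZ's rational shape: numerator `P(X₀X₁X₂)`, denominator `1 − (X₀X₁X₂)ᴸ`,
non-vanishing on the cube since `0 ≤ x₀x₁x₂ < 1`. [cite: KontsevichZagier2001, §1.1] -/
theorem isRational_of_hurwitzSectorThree (L : ℕ) (hL : L ≠ 0) (r : IntegralRep 3) (P : Polynomial ℚ)
    (hr : r.domain = {x | ∀ i, x i ∈ Set.Ioo (0:ℝ) 1})
    (hP : EqOn r.integrand
      (fun x => Polynomial.aeval (x 0 * x 1 * x 2) P / (1 - (x 0 * x 1 * x 2) ^ L)) r.domain) :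
    r.IsRational := by
  refine ⟨Polynomial.aeval
      (MvPolynomial.X 0 * MvPolynomial.X 1 * MvPolynomial.X 2 : MvPolynomial (Fin 3) ℚ) P,
    1 - (MvPolynomial.X 0 * MvPolynomial.X 1 * MvPolynomial.X 2) ^ L, fun x hx => ?_, fun x hx => ?_⟩
  · rw [hr] at hx
    have h0 : 0 ≤ x 0 * x 1 := mul_nonneg (hx 0).1.le (hx 1).1.le
    have h1 : x 0 * x 1 < 1 := mul_lt_one_of_nonneg_of_lt_one_left (hx 0).1.le (hx 0).2 (hx 1).2.le
    have h0' : 0 ≤ x 0 * x 1 * x 2 := mul_nonneg h0 (hx 2).1.le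
    have h1' : x 0 * x 1 * x 2 < 1 := mul_lt_one_of_nonneg_of_lt_one_left h0 h1 (hx 2).2.le
    simp only [map_sub, map_one, map_pow, map_mul, MvPolynomial.aeval_X]
    exact (sub_pos.mpr (pow_lt_one₀ h0' h1' hL)).ne'
  · show r.integrand x = MvPolynomial.aeval x (Polynomial.aeval _ P) / MvPolynomial.aeval x _
    rw [hP hx, ← Polynomial.aeval_algHom_apply]
    simp

/-- **V2211 ⇒ Conjecture 1 on every weight-2 Hurwitz box sector `P(t)/(1 − tᴸ)`, `t = x₀x₁`, any
level `L ≠ 0`, with NO linear-independence input** (sector members are box-rational: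
`isRational_of_sectorTwo`, `…Variants2204`) — e.g. `L = 4`: the conclusion of the route's
`CatalanSectorTwoFour` without its open hypothesis `Indep_ℚ(1, π², G)`; `L = 6`: `SectorTwoSix`
without Calegari–Dimitrov–Tang. [cite: KontsevichZagier2001, §1.2 Conjecture 1] -/
theorem sectorTwo_of_stub_boxRigidity_var2211
    (h : ∀ (m m' : ℕ) (N : IntegralRep m) (N' : IntegralRep m'), m' ≤ 3 → m ≤ 2 → N.domain = {x | ∀ i, x i ∈ Set.Ioo (0:ℝ) 1} → N.IsRational → N'.domain = {x | ∀ i, x i ∈ Set.Ioo (0:ℝ) 1} → N'.IsRational → N.value = N'.value → Equivalent N N')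
    (L : ℕ) (hL : L ≠ 0) :
    ∀ (r r' : IntegralRep 2) (P P' : Polynomial ℚ), r.domain = {x | ∀ i, x i ∈ Set.Ioo (0:ℝ) 1} →
      r'.domain = {x | ∀ i, x i ∈ Set.Ioo (0:ℝ) 1} →
      EqOn r.integrand (fun x => Polynomial.aeval (x 0 * x 1) P / (1 - (x 0 * x 1) ^ L)) r.domain →
      EqOn r'.integrand (fun x => Polynomial.aeval (x 0 * x 1) P' / (1 - (x 0 * x 1) ^ L)) r'.domain →
      r.value = r'.value → Equivalent r r' :=
  fun r r' P P' hr hr' hP hP' hv =>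
    h 2 2 r r' (by norm_num) le_rfl hr (isRational_of_sectorTwo L hL r P hr hP) hr'
      (isRational_of_sectorTwo L hL r' P' hr' hP') hv

/-- **V2211 ⇒ Conjecture 1 on every weight-3 Hurwitz box sector `P(t)/(1 − tᴸ)`, `t = x₀x₁x₂`, any
level `L ≠ 0`, with NO linear-independence input** — e.g. `L = 2`: `AperySectorThreeTwo` without
Apéry's theorem; `L = 3`: the `(3,3)` rung, which the route can only file against the open
`Indep_ℚ(1, ζ(3), π³√3)`. [cite: KontsevichZagier2001, §1.2 Conjecture 1] -/
theorem sectorThree_of_stub_boxRigidity_var2211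
    (h : ∀ (m m' : ℕ) (N : IntegralRep m) (N' : IntegralRep m'), m' ≤ 3 → m ≤ 2 → N.domain = {x | ∀ i, x i ∈ Set.Ioo (0:ℝ) 1} → N.IsRational → N'.domain = {x | ∀ i, x i ∈ Set.Ioo (0:ℝ) 1} → N'.IsRational → N.value = N'.value → Equivalent N N')
    (L : ℕ) (hL : L ≠ 0) :
    ∀ (r r' : IntegralRep 3) (P P' : Polynomial ℚ), r.domain = {x | ∀ i, x i ∈ Set.Ioo (0:ℝ) 1} →
      r'.domain = {x | ∀ i, x i ∈ Set.Ioo (0:ℝ) 1} →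
      EqOn r.integrand
        (fun x => Polynomial.aeval (x 0 * x 1 * x 2) P / (1 - (x 0 * x 1 * x 2) ^ L)) r.domain →
      EqOn r'.integrand
        (fun x => Polynomial.aeval (x 0 * x 1 * x 2) P' / (1 - (x 0 * x 1 * x 2) ^ L)) r'.domain →
      r.value = r'.value → Equivalent r r' :=
  fun r r' P P' hr hr' hP hP' hv =>
    stub_boxRigidity_var2211_iff_three_three.1 h r r' hr (isRational_of_hurwitzSectorThree L hL r P hr hP)
      hr' (isRational_of_hurwitzSectorThree L hL r' P' hr' hP') hv

end Summit.KontsevichZagierPeriods.KontsevichZagierPeriods.Theorems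

end
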